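import Summits.BirchSwinnertonDyer.Rank1Residual.O6.KatoHullRankOneExactCount
import Summits.BirchSwinnertonDyer.Rank1Residual.O6.X3KatoMemberBoundMuDefect
import Summits.BirchSwinnertonDyer.Rank1Residual.Additive.KatoDescentRankOnePerrinRiou
import HarnessLib

/-!
# O6 / O5 / B8: the rank-ONE Kato descent AT A REALISED MEMBER (any torsion, any image) — the defect
# identity `ord_p #Ш_an = ord_p #Ш + m`, `U₁ ⟸ PR^× + divisibility`, `KMC ∧ PR^× ⟹ BSD_p`,
# `KMC ⟹ (BSD_p ⟺ PR^×)`, and KMC ⟹ Perrin-Riou's non-vanishing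
# (cell `bsd-potss`, seat `kmc`, generation 8; part 15b-ii of the descent files; kernel assemblies over
# Reading M3♯-r1 of `KatoHullRankOneExactCount.lean`; nothing asserted)

HONEST FRAMING (cell `bsd-potss`, `run/shared/lean/pub/bsd-potss/`, FULL-BSD rank-`≤ 1` programme
tranche 1b, rows B5 = O6 wild `3` (X3 r1 9 376 + X4 r1 5 348 S-b pairs), B4 (t′) r1, B8 = O7-ss):
NOTHING about Kato's objects or Perrin-Riou's conjecture is asserted and no Literature fact is minted;
every theorem is CONDITIONAL over the displayed readings of the sibling file (`KatoHull.RankOneExactCountReading`,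
`KatoHull.HasPRRatio`, `KatoHull.ReadsKMC`), the conjecture node `PerrinRiouUpToUnitAt PRRatio W p`
(PR^×, part 5) and the named facts GZK / modularity (audit `proof.conditional`); no route item or node
is closed; nothing is booked. The mathematics (memo v7 §2, F1–F7) is in the sibling's module docstring:
at a hull-realised member `W` of analytic rank one, **`v_p ℒ = m + ord_p #Ш + v_p Tam − 2t`**, hence,
granted PR^× (`v_p ℒ = ord_p(L′/(Ω·Reg))`), **`ord_p #Ш_an(W) = ord_p #Ш(W) + m`** — the same defect
identity as in analytic rank `0` (part 14), with the same consequences member-wise; and under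
Conj. 12.10 the zeta element survives at the bottom layer (part 15a), which is Perrin-Riou's
non-vanishing. = Burns–Kurihara–Sano Thm. 7.3 / 7.6 at `r = 1` with their standing Hyp. 2.2 (i)
("`H¹(ℤ_S,T)` is `ℤ_p`-free", i.e. `t = 0`) REMOVED, in Kato's `𝐇²`-formalism through the hull.

Contents (§4 of part 15): `KatoHull.rankOne_exists_shaAn_eq_of_perrinRiou` (the defect identity),
`KatoHull.rankOne_missingUpperBoundAt_of_perrinRiou` (U₁ ⟸ PR^× + the divisibility for the hull — NO
Main Conjecture; the rank-one analogue of Thm. 14.5 (3)), `KatoHull.rankOne_missingPPartAt_of_kmc_of_perrinRiou`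
/ `…bsdp…`, `KatoHull.rankOne_kmc_of_missingLowerBoundAt_of_perrinRiou` / `…of_bsdp…`,
`KatoHull.rankOne_kmc_iff_bsdp_of_perrinRiou`, `KatoHull.perrinRiou_nonvanishing_of_kmc`,
`KatoHull.perrinRiou_of_kmc_of_missingPPartAt` (Burns–Kurihara–Sano Thm. 7.3 at a member WITH torsion),
`KatoHull.missingPPartAt_iff_perrinRiou_of_kmc`.

WHAT THIS IS NOT. Not a proof of any route item or node (conditional); not a construction of `𝐇^q(T)`,
`z_γ`, the hull, `H^q(ℤ[1/p],T)` or `ℒ` (interfaces; D-O6-2 stands); not a proof of Perrin-Riou's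
conjecture anywhere; nothing at `p = 2`, at a potentially multiplicative `p`, or in analytic rank `≠ 1`.

References: [Kato2004Asterisque] Thm. 12.5 (3)–(4), Thm. 12.6 (p. 222), Conj. 12.10 (p. 224), Thm.
14.5 and `[M : z]` (pp. 236–237), §14.14 and Lemma 14.15 (pp. 243–244); [BurnsKuriharaSano2019] Hyp.
2.2 (p. 9), Conj. 2.8 (p. 10), Thm. 7.3, Thm. 7.6, Rem. 7.7 (p. 29), Thm. 7.8 (d) (p. 30);
[PerrinRiou1993AIF] §3.3; [Wuthrich2014] Lemma 14 (p. 396); [Miller2011LMS] Def. 1.1.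
-/

set_option autoImplicit false

noncomputable section

open scoped Classical

open WeierstrassCurve Literature.NumberTheory.EllipticCurves
  Literature.NumberTheory.EllipticCurves.ModularForms
  Literature.NumberTheory.EllipticCurves.Rank1Residual
  Literature.NumberTheory.EllipticCurves.Rank1Residual.Typed
  Literature.NumberTheory.EllipticCurves.IwasawaAlgebra

/-! ## §4 Consequences at a realised member -/

namespace Summit.BirchSwinnertonDyer.Rank1Residual

open Additive

variable {IsHullOf : ∀ (W : WeierstrassCurve ℚ) [W.IsElliptic] [W.IsGloballyMinimal] (p : ℕ)
  [Fact p.Prime], KatoHullDescentDatum p → Prop}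
variable {PRRatio : ∀ (W : WeierstrassCurve ℚ) [W.IsElliptic] [W.IsGloballyMinimal] (p : ℕ)
  [Fact p.Prime], ℚ_[p] → Prop}
variable {KMC : ∀ (W : WeierstrassCurve ℚ) [W.IsElliptic] [W.IsGloballyMinimal] (p : ℕ), Prop}

/-- **THE RANK-ONE DEFECT IDENTITY at a realised member, granted PR^×: `ord_p #Ш_an(W) = ord_p #Ш(W) +
m(D)`** — Reading M3♯-r1 gives `v_p ℒ = m + ord_p #Ш + v_p Tam − 2t`, PR^× gives `v_p ℒ =
ord_p(L′/(Ω·Reg))` (and `ℒ ≠ 0`, hence `[A : y] ≠ 0`), and `#Ш_an = (L′/(Ω·Reg))·#tors²/Tam`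
(modularity `hmod` for `L′(W,1) ≠ 0`, GZK for the finiteness of `Ш`). The SAME identity as part 14's
rank-`0` `KatoHull.exists_shaAn_eq_of_reading`. Conditional over the displayed reading and the node
PR^×; nothing asserted. [cite: BurnsKuriharaSano2019, Thm. 7.3 (p. 29)] [cite: Kato2004Asterisque, §14.14 (p. 243), `[M : z]` (pp. 236–237)]
[cite: Miller2011LMS, Def. 1.1] -/
theorem KatoHull.rankOne_exists_shaAn_eq_of_perrinRiou
    (hC : KatoHull.RankOneExactCountReading IsHullOf PRRatio)
    (hGZK : rank_eq_analyticRank_of_analyticRank_le_one) (hmod : hasEntireLFunction_rat)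
    {W : WeierstrassCurve ℚ} [W.IsElliptic] [W.IsGloballyMinimal] {p : ℕ} [Fact p.Prime]
    {D : KatoHullDescentDatum p} (hp : p ≠ 2) (hadd : Addv W p) (hj : 0 ≤ padicValRat p W.j)
    (hr : W.analyticRank = 1) (hDof : IsHullOf W p D) (hPR : PerrinRiouUpToUnitAt PRRatio W p) :
    Finite (coinvariants p D.H2) ∧ D.yIndex ≠ 0 ∧
      ∃ q' : ℚ, shaAn W = (q' : ℂ) ∧ padicValRat p q' = (padicValNat p W.shaOrder : ℤ) + D.muExp := by
  have hfin : Finite W.sha := (hGZK W (by rw [hr])).2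
  obtain ⟨ℒ, hℒ, hne, q, hq, hv⟩ := hPR hr
  obtain ⟨hfin2, hiff, hcount⟩ := hC W p D ℒ hr hp hadd hj hfin hDof hℒ
  have hy : D.yIndex ≠ 0 := hiff.mp hne
  refine ⟨hfin2, hy, ?_⟩
  have hval := hcount hy
  obtain ⟨q', hq', hv'⟩ := exists_shaAn_eq_of_leadingTerm_eq_torsion W p
    (W.leadingLCoeff_ne_zero_holds (hmod W)) hq
  refine ⟨q', hq', ?_⟩
  rw [hv', ← hv, ← KatoHull.padicValNat_primaryComponent_sha W p hfin]
  unfold KatoHullDescentDatum.muExp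
  linarith

/-- **THE UPPER HALF IN ANALYTIC RANK ONE FROM PR^× AND THE DIVISIBILITY ALONE — no Main Conjecture.**
At a hull-realised member `W` of analytic rank `1`: Reading M3♯-r1, PR^× and the divisibility for the
hull at the datum (`m ≥ 0`: Kato's Thm. 12.5 (3) off `(p)` plus `μ(𝐇²(T)⁰) = 0`, e.g. Wuthrich's
Lemma 14 on reducible rows, Thm. 12.5 (4) under (12.5.2)) give `ord_p #Ш(W) ≤ ord_p #Ш_an(W)`
(`MissingUpperBoundAt W p`) — the rank-one analogue of Kato's Thm. 14.5 (3), with Perrin-Riou's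
formula up to a unit in place of `L(E,1) ≠ 0`. Conditional over displayed readings; nothing asserted.
[cite: Kato2004Asterisque, Thm. 12.5 (3)–(4) (p. 222), Thm. 14.5 (3) (p. 236)] [cite: BurnsKuriharaSano2019, Thm. 7.3 (p. 29), Conj. 2.8 (p. 10)]
[cite: Wuthrich2014, Lemma 14 (p. 396)] -/
theorem KatoHull.rankOne_missingUpperBoundAt_of_perrinRiou
    (hC : KatoHull.RankOneExactCountReading IsHullOf PRRatio)
    (hGZK : rank_eq_analyticRank_of_analyticRank_le_one) (hmod : hasEntireLFunction_rat)
    {W : WeierstrassCurve ℚ} [W.IsElliptic] [W.IsGloballyMinimal] {p : ℕ} [Fact p.Prime]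
    {D : KatoHullDescentDatum p} (hp : p ≠ 2) (hadd : Addv W p) (hj : 0 ≤ padicValRat p W.j)
    (hr : W.analyticRank = 1) (hDof : IsHullOf W p D) (hdiv : D.HullDivisibility)
    (hPR : PerrinRiouUpToUnitAt PRRatio W p) : MissingUpperBoundAt W p := by
  obtain ⟨hfin2, hy, q', hq', hv⟩ :=
    KatoHull.rankOne_exists_shaAn_eq_of_perrinRiou hC hGZK hmod hp hadd hj hr hDof hPR
  have hm : 0 ≤ D.muExp := D.muExp_nonneg_of_hullDivisibility hdiv hfin2 hy
  exact ⟨q', hq', by rw [hv]; linarith⟩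

/-- **KMC ∧ PR^× ⟹ the missing `p`-part AT A REALISED MEMBER of analytic rank one** (any torsion, any
image): Kato's Main Conjecture read on the hull datum of `W` (`ReadsKMC`) gives `m = 0`, and the
defect identity gives `ord_p #Ш_an = ord_p #Ш`. = Burns–Kurihara–Sano Thm. 7.6 at `r = 1` WITHOUT
their Hyp. 2.2 (i) (members with rational `p`-torsion allowed), in Kato's `𝐇²`-formalism through the
reflexive hull. No torsion-free member, no isogeny transport, no `p`-adic height. Conditional over
displayed readings; nothing asserted.
[cite: BurnsKuriharaSano2019, Thm. 7.6 and Remark 7.7 (p. 29), Hyp. 2.2 (p. 9)] [cite: Kato2004Asterisque, Conj. 12.10 (p. 224), §14.14 (p. 243)] -/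
theorem KatoHull.rankOne_missingPPartAt_of_kmc_of_perrinRiou
    (hC : KatoHull.RankOneExactCountReading IsHullOf PRRatio) (hK : KatoHull.ReadsKMC IsHullOf KMC)
    (hGZK : rank_eq_analyticRank_of_analyticRank_le_one) (hmod : hasEntireLFunction_rat)
    {W : WeierstrassCurve ℚ} [W.IsElliptic] [W.IsGloballyMinimal] {p : ℕ} [Fact p.Prime]
    {D : KatoHullDescentDatum p} (hp : p ≠ 2) (hadd : Addv W p) (hj : 0 ≤ padicValRat p W.j)
    (hr : W.analyticRank = 1) (hDof : IsHullOf W p D) (hkmc : KMC W p)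
    (hPR : PerrinRiouUpToUnitAt PRRatio W p) : MissingPPartAt W p := by
  obtain ⟨hfin2, hy, q', hq', hv⟩ :=
    KatoHull.rankOne_exists_shaAn_eq_of_perrinRiou hC hGZK hmod hp hadd hj hr hDof hPR
  have hm : D.muExp = 0 := D.muExp_eq_zero_of_conj1210 ((hK W p D hDof).mp hkmc) hfin2 hy
  exact ⟨q', hq', by rw [hv, hm, add_zero]⟩

/-- **KMC ∧ PR^× ⟹ `BSD(E,p)` at a realised member of analytic rank one** (Miller's `BSDp`).
[cite: BurnsKuriharaSano2019, Thm. 7.6 (p. 29)] [cite: Miller2011LMS, Def. 1.1] -/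
theorem KatoHull.rankOne_bsdp_of_kmc_of_perrinRiou
    (hC : KatoHull.RankOneExactCountReading IsHullOf PRRatio) (hK : KatoHull.ReadsKMC IsHullOf KMC)
    (hGZK : rank_eq_analyticRank_of_analyticRank_le_one) (hmod : hasEntireLFunction_rat)
    {W : WeierstrassCurve ℚ} [W.IsElliptic] [W.IsGloballyMinimal] {p : ℕ} [Fact p.Prime]
    {D : KatoHullDescentDatum p} (hp : p ≠ 2) (hadd : Addv W p) (hj : 0 ≤ padicValRat p W.j)
    (hr : W.analyticRank = 1) (hDof : IsHullOf W p D) (hkmc : KMC W p)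
    (hPR : PerrinRiouUpToUnitAt PRRatio W p) : BSDp W p :=
  bsdp_of_missingPPartAt W p hGZK (by rw [hr])
    (KatoHull.rankOne_missingPPartAt_of_kmc_of_perrinRiou hC hK hGZK hmod hp hadd hj hr hDof hkmc hPR)

/-- **PR^× ∧ (BSD_p's LOWER half) ⟹ KMC at a realised member of analytic rank one**, granted the
divisibility for the hull at the datum: the defect identity and the lower bound force `m ≤ 0`, the
divisibility `m ≥ 0`, and `m = 0` with the divisibility is Conj. 12.10 on the hull (the converse
descent, part 14). So every rank-one row closed by ANY means proves Kato's Main Conjecture for that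
curve GRANTED PR^× there. Conditional over displayed readings; nothing asserted.
[cite: Kato2004Asterisque, Thm. 12.5 (3)–(4) (p. 222), Conj. 12.10 (p. 224), §14.14 (p. 243)] [cite: BurnsKuriharaSano2019, Thm. 7.3 (p. 29)] -/
theorem KatoHull.rankOne_kmc_of_missingLowerBoundAt_of_perrinRiou
    (hC : KatoHull.RankOneExactCountReading IsHullOf PRRatio) (hK : KatoHull.ReadsKMC IsHullOf KMC)
    (hGZK : rank_eq_analyticRank_of_analyticRank_le_one) (hmod : hasEntireLFunction_rat)
    {W : WeierstrassCurve ℚ} [W.IsElliptic] [W.IsGloballyMinimal] {p : ℕ} [Fact p.Prime]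
    {D : KatoHullDescentDatum p} (hp : p ≠ 2) (hadd : Addv W p) (hj : 0 ≤ padicValRat p W.j)
    (hr : W.analyticRank = 1) (hDof : IsHullOf W p D) (hdiv : D.HullDivisibility)
    (hPR : PerrinRiouUpToUnitAt PRRatio W p) (hlow : MissingLowerBoundAt W p) : KMC W p := by
  obtain ⟨hfin2, hy, q', hq', hv⟩ :=
    KatoHull.rankOne_exists_shaAn_eq_of_perrinRiou hC hGZK hmod hp hadd hj hr hDof hPR
  have hm0 : 0 ≤ D.muExp := D.muExp_nonneg_of_hullDivisibility hdiv hfin2 hy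
  obtain ⟨q'', hq'', hle⟩ := hlow
  have hqq : q'' = q' := by exact_mod_cast hq''.symm.trans hq'
  subst hqq
  have hm : D.muExp = 0 := by rw [hv] at hle; linarith
  exact (hK W p D hDof).mpr (D.conj1210_of_muExp_eq_zero hdiv hfin2 hy hm)

/-- **PR^× ∧ BSD_p ⟹ KMC at a realised member of analytic rank one** (granted the divisibility for the
hull). [cite: Kato2004Asterisque, Conj. 12.10 (p. 224), Thm. 12.5 (3)–(4) (p. 222)] [cite: BurnsKuriharaSano2019, Thm. 7.3 (p. 29)] -/
theorem KatoHull.rankOne_kmc_of_bsdp_of_perrinRiou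
    (hC : KatoHull.RankOneExactCountReading IsHullOf PRRatio) (hK : KatoHull.ReadsKMC IsHullOf KMC)
    (hGZK : rank_eq_analyticRank_of_analyticRank_le_one) (hmod : hasEntireLFunction_rat)
    {W : WeierstrassCurve ℚ} [W.IsElliptic] [W.IsGloballyMinimal] {p : ℕ} [Fact p.Prime]
    {D : KatoHullDescentDatum p} (hp : p ≠ 2) (hadd : Addv W p) (hj : 0 ≤ padicValRat p W.j)
    (hr : W.analyticRank = 1) (hDof : IsHullOf W p D) (hdiv : D.HullDivisibility)
    (hPR : PerrinRiouUpToUnitAt PRRatio W p) (h : BSDp W p) : KMC W p := by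
  haveI : Finite W.sha := (hGZK W (by rw [hr])).2
  exact KatoHull.rankOne_kmc_of_missingLowerBoundAt_of_perrinRiou hC hK hGZK hmod hp hadd hj hr hDof
    hdiv hPR (lower_and_upper_of_missingPPartAt W p (missingPPartAt_of_bsdp W p h)).1

/-- **Rank one, GRANTED PR^× at the member: `KMC_p(W) ⟺ BSD_p(W)`** at every hull-realised member,
granted the divisibility for the hull at the datum (PROPOSITION M of `O6/MainConjectureEvenIffBSD.lean`
in analytic rank ONE at an arbitrary member). [cite: Kato2004Asterisque, Conj. 12.10 (p. 224), Thm. 12.5 (3)–(4) (p. 222)]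
[cite: BurnsKuriharaSano2019, Thm. 7.3 and Thm. 7.6 (p. 29)] -/
theorem KatoHull.rankOne_kmc_iff_bsdp_of_perrinRiou
    (hC : KatoHull.RankOneExactCountReading IsHullOf PRRatio) (hK : KatoHull.ReadsKMC IsHullOf KMC)
    (hGZK : rank_eq_analyticRank_of_analyticRank_le_one) (hmod : hasEntireLFunction_rat)
    {W : WeierstrassCurve ℚ} [W.IsElliptic] [W.IsGloballyMinimal] {p : ℕ} [Fact p.Prime]
    {D : KatoHullDescentDatum p} (hp : p ≠ 2) (hadd : Addv W p) (hj : 0 ≤ padicValRat p W.j)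
    (hr : W.analyticRank = 1) (hDof : IsHullOf W p D) (hdiv : D.HullDivisibility)
    (hPR : PerrinRiouUpToUnitAt PRRatio W p) : KMC W p ↔ BSDp W p :=
  ⟨fun h ↦ KatoHull.rankOne_bsdp_of_kmc_of_perrinRiou hC hK hGZK hmod hp hadd hj hr hDof h hPR,
    KatoHull.rankOne_kmc_of_bsdp_of_perrinRiou hC hK hGZK hmod hp hadd hj hr hDof hdiv hPR⟩

/-- **KMC ⟹ PERRIN-RIOU'S NON-VANISHING at a realised member of analytic rank one** (`ℒ ≠ 0`, i.e. the
bottom layer `z_ℚ` of the zeta element is non-torsion in `H¹(ℤ[1/p],T)`; Burns–Kurihara–Sano Conj.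
2.8 (i)): Conj. 12.10 on the hull datum makes `ℓ_{(T)}(F/Λz) = ℓ_{(T)}(𝐇²(T)⁰) = 0`, hence
`[A : y] ≠ 0` (part 15a), and Reading M3♯-r1 (ii) translates. ANY image, any torsion. Conditional over
displayed readings; nothing asserted.
[cite: BurnsKuriharaSano2019, Conj. 2.8 (i) (p. 10)] [cite: Kato2004Asterisque, Conj. 12.10 (p. 224), §14.14 and Lemma 14.15 (pp. 243–244)] -/
theorem KatoHull.perrinRiou_nonvanishing_of_kmc
    (hC : KatoHull.RankOneExactCountReading IsHullOf PRRatio) (hK : KatoHull.ReadsKMC IsHullOf KMC)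
    (hGZK : rank_eq_analyticRank_of_analyticRank_le_one)
    {W : WeierstrassCurve ℚ} [W.IsElliptic] [W.IsGloballyMinimal] {p : ℕ} [Fact p.Prime]
    {D : KatoHullDescentDatum p} (hp : p ≠ 2) (hadd : Addv W p) (hj : 0 ≤ padicValRat p W.j)
    (hr : W.analyticRank = 1) (hDof : IsHullOf W p D) (hkmc : KMC W p) {ℒ : ℚ_[p]}
    (hℒ : PRRatio W p ℒ) : ℒ ≠ 0 := by
  have hfin : Finite W.sha := (hGZK W (by rw [hr])).2
  obtain ⟨hfin2, hiff, -⟩ := hC W p D ℒ hr hp hadd hj hfin hDof hℒ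
  exact hiff.mpr (D.yIndex_ne_zero_of_conj1210 ((hK W p D hDof).mp hkmc) hfin2)

/-- **The Burns–Kurihara–Sano direction AT A MEMBER WITH TORSION: KMC ∧ BSD_p ⟹ PR^×** (their Thm. 7.3
at `r = 1` — the Main Conjecture ALONE pins `z = u·(#Ш·Tam/#tors²)·log_ω(x)·x`, `u ∈ ℤ_p^×` — with
Hyp. 2.2 (i) removed: over Reading M3♯-r1 the Main Conjecture gives `ℒ ≠ 0` (the survival of the zeta
element, part 15a) and `v_p ℒ = ord_p #Ш + v_p Tam − 2t`; with BSD_p this is `ord_p(L′/(Ω·Reg))`).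
Conditional over displayed readings (`hrat`: the ratio is defined, Reading M4♯); nothing asserted.
[cite: BurnsKuriharaSano2019, Thm. 7.3 (p. 29), Thm. 7.8 (d) (p. 30), Hyp. 2.2 (p. 9)] [cite: Kato2004Asterisque, Conj. 12.10 (p. 224)] -/
theorem KatoHull.perrinRiou_of_kmc_of_missingPPartAt
    (hC : KatoHull.RankOneExactCountReading IsHullOf PRRatio) (hrat : KatoHull.HasPRRatio PRRatio)
    (hK : KatoHull.ReadsKMC IsHullOf KMC) (hGZK : rank_eq_analyticRank_of_analyticRank_le_one)
    (hmod : hasEntireLFunction_rat)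
    {W : WeierstrassCurve ℚ} [W.IsElliptic] [W.IsGloballyMinimal] {p : ℕ} [Fact p.Prime]
    {D : KatoHullDescentDatum p} (hp : p ≠ 2) (hadd : Addv W p) (hj : 0 ≤ padicValRat p W.j)
    (hr : W.analyticRank = 1) (hDof : IsHullOf W p D) (hkmc : KMC W p) (hbsd : MissingPPartAt W p) :
    PerrinRiouUpToUnitAt PRRatio W p := by
  intro _
  have hfin : Finite W.sha := (hGZK W (by rw [hr])).2
  obtain ⟨ℒ, hℒ⟩ := hrat W p hr hp hadd hj
  obtain ⟨hfin2, hiff, hcount⟩ := hC W p D ℒ hr hp hadd hj hfin hDof hℒ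
  have hMC : D.Conj1210 := (hK W p D hDof).mp hkmc
  have hy : D.yIndex ≠ 0 := D.yIndex_ne_zero_of_conj1210 hMC hfin2
  have hne : ℒ ≠ 0 := hiff.mpr hy
  have hm : D.muExp = 0 := D.muExp_eq_zero_of_conj1210 hMC hfin2 hy
  have hval := hcount hy
  obtain ⟨q', hq', hv'⟩ := hbsd
  obtain ⟨q, hq, hvq⟩ := exists_leadingTerm_eq_of_shaAn_eq_torsion W p
    (W.leadingLCoeff_ne_zero_holds (hmod W)) hq'
  refine ⟨ℒ, hℒ, hne, q, hq, ?_⟩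
  rw [hvq, hv', ← KatoHull.padicValNat_primaryComponent_sha W p hfin]
  unfold KatoHullDescentDatum.muExp at hm
  linarith

/-- **Rank one, GRANTED KMC at the member: `BSD_p ⟺ PR^×`** — the rank-one residue after Kato's Main
Conjecture is EXACTLY Perrin-Riou's formula up to a unit, at every hull-realised member (any torsion,
any image). [cite: BurnsKuriharaSano2019, Thm. 7.3 and Thm. 7.6 (p. 29)] [cite: Kato2004Asterisque, Conj. 12.10 (p. 224)] -/
theorem KatoHull.missingPPartAt_iff_perrinRiou_of_kmc
    (hC : KatoHull.RankOneExactCountReading IsHullOf PRRatio) (hrat : KatoHull.HasPRRatio PRRatio)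
    (hK : KatoHull.ReadsKMC IsHullOf KMC) (hGZK : rank_eq_analyticRank_of_analyticRank_le_one)
    (hmod : hasEntireLFunction_rat)
    {W : WeierstrassCurve ℚ} [W.IsElliptic] [W.IsGloballyMinimal] {p : ℕ} [Fact p.Prime]
    {D : KatoHullDescentDatum p} (hp : p ≠ 2) (hadd : Addv W p) (hj : 0 ≤ padicValRat p W.j)
    (hr : W.analyticRank = 1) (hDof : IsHullOf W p D) (hkmc : KMC W p) :
    MissingPPartAt W p ↔ PerrinRiouUpToUnitAt PRRatio W p :=
  ⟨KatoHull.perrinRiou_of_kmc_of_missingPPartAt hC hrat hK hGZK hmod hp hadd hj hr hDof hkmc,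
    KatoHull.rankOne_missingPPartAt_of_kmc_of_perrinRiou hC hK hGZK hmod hp hadd hj hr hDof hkmc⟩

/-- **The rank-one UPPER HALF modulo `μ(𝐇²(T)⁰)` on the rows WITHOUT the divisibility at `(p)`** (irreducible
`E[p]` with the `p`-adic tower not surjective: Kato's 12.5 (4) is void there; cf. part 14f for rank `0`):
Reading M3♯-r1, PR^× and the divisibility OFF `(p)` (`HullDivisibilityOffP`: Thm. 12.5 (3), image-free) give
`ord_p #Ш(W) ≤ ord_p #Ш_an(W) + μ(𝐇²(T)⁰)` — the "index error" is the ONE named quantity `μ(𝐇²(T)⁰)`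
(`= 0` ⟺ Coates–Sujatha Conj. A), exactly as in rank `0` (`KatoHull.sha_le_shaAn_add_muH2`). Conditional
over displayed readings; nothing asserted. [cite: Kato2004Asterisque, Thm. 12.5 (3) (p. 222), Lemma 14.15 (p. 244)]
[cite: CoatesSujatha2005, Conjecture A and Thm. 3.4] [cite: BurnsKuriharaSano2019, Thm. 7.3 (p. 29)] -/
theorem KatoHull.rankOne_sha_le_shaAn_add_muH2_of_perrinRiou
    (hC : KatoHull.RankOneExactCountReading IsHullOf PRRatio)
    (hGZK : rank_eq_analyticRank_of_analyticRank_le_one) (hmod : hasEntireLFunction_rat)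
    {W : WeierstrassCurve ℚ} [W.IsElliptic] [W.IsGloballyMinimal] {p : ℕ} [Fact p.Prime]
    {D : KatoHullDescentDatum p} (hp : p ≠ 2) (hadd : Addv W p) (hj : 0 ≤ padicValRat p W.j)
    (hr : W.analyticRank = 1) (hDof : IsHullOf W p D) (hoff : D.HullDivisibilityOffP)
    (hPR : PerrinRiouUpToUnitAt PRRatio W p) :
    ∃ q' : ℚ, shaAn W = (q' : ℂ) ∧
      (padicValNat p W.shaOrder : ℤ) ≤ padicValRat p q' + D.muH2 := by
  obtain ⟨hfin2, hy, q', hq', hv⟩ :=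
    KatoHull.rankOne_exists_shaAn_eq_of_perrinRiou hC hGZK hmod hp hadd hj hr hDof hPR
  have hm : -(D.muH2 : ℤ) ≤ D.muExp := D.neg_muH2_le_muExp hoff hfin2 hy
  exact ⟨q', hq', by rw [hv]; linarith⟩

/-- **… and the rank-one upper half `MissingUpperBoundAt W p` when `μ(𝐇²(T)⁰) = 0`** (Coates–Sujatha
Conj. A at the pair), from PR^× and the divisibility off `(p)` — NO Main Conjecture, NO (12.5.2).
[cite: Kato2004Asterisque, Thm. 12.5 (3) (p. 222)] [cite: CoatesSujatha2005, Conjecture A] [cite: BurnsKuriharaSano2019, Thm. 7.3 (p. 29)] -/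
theorem KatoHull.rankOne_missingUpperBoundAt_of_perrinRiou_of_muH2_eq_zero
    (hC : KatoHull.RankOneExactCountReading IsHullOf PRRatio)
    (hGZK : rank_eq_analyticRank_of_analyticRank_le_one) (hmod : hasEntireLFunction_rat)
    {W : WeierstrassCurve ℚ} [W.IsElliptic] [W.IsGloballyMinimal] {p : ℕ} [Fact p.Prime]
    {D : KatoHullDescentDatum p} (hp : p ≠ 2) (hadd : Addv W p) (hj : 0 ≤ padicValRat p W.j)
    (hr : W.analyticRank = 1) (hDof : IsHullOf W p D) (hoff : D.HullDivisibilityOffP)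
    (hμ : D.muH2 = 0) (hPR : PerrinRiouUpToUnitAt PRRatio W p) : MissingUpperBoundAt W p :=
  KatoHull.rankOne_missingUpperBoundAt_of_perrinRiou hC hGZK hmod hp hadd hj hr hDof
    (D.hullDivisibility_of_offP_of_muH2_eq_zero hoff hμ) hPR

end Summit.BirchSwinnertonDyer.Rank1Residual

end
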